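import Mathlib
import Summits.NavierStokesRegularity.FluidComputer.AbcClassIIBases
import Summits.NavierStokesRegularity.FluidComputer.AbcClassIIOpenBracketCertificate

/-!
# Class-II layer of the skew-cut X0 chain, Part A2′/A3: the OPEN bracket and rung R-α from the
# certificate's three numbers in ARBITRARY orbit bases
(instab4 g7 — implementation 2 of the skew-cut X0 certifier, cell `ns-blowup`, 2026-08-27)

HONEST FRAMING (human ruling D-0035): nothing here is a claim about Navier–Stokes blow-up.
WHAT THIS IS NOT: not NS evidence. MODEL lane (Navier–Stokes linearised about the forced ABC flow
`U = abcFlow 1 1 1`, `f = νU`); no certificate, number or census word moves.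

Compositions only: the basis-transfer lemmas of `AbcClassIIBases` (instab4 g7: (T1) `head_sign_transfer`,
(T2) `shell_form_transfer`, from an arbitrary family `e O` of real orthonormal bases of the class-II
orbit spaces `realSpace O` to the existential basis `bfam`) feed implementation 1's class-II open-bracket
theorems `AbcClassIIOpenBracket.isLinNSEigenvalue_Ioo_of_certificate` /
`isLyapunovUnstable_of_certificate` (instab3 g6). Result: from the certificate's three numbers stated
about the section matrices `[(x + |O|²/R)δ − am]` of the first-order matrix `am` of ANY such basis family
— **`isLinNSEigenvalue_Ioo_of_certificate_of_bases`** (`∃ λ ∈ (x₁, x₂)` OPEN,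
`Torus.IsLinNSEigenvalue (1/(2πR)) (Torus.abcFlow 1 1 1) (2πλ)`) and, with `0 ≤ x₁` and the named fact
FPS06 Thm 2.2, **`isLyapunovUnstable_of_certificate_of_bases`** (rung R-α: the forced ABC flow is a
Lyapunov-unstable steady state of the true forced dynamics — an INSTABILITY statement, not blow-up).
These are the statements a CERTIFIER AUDIT discharges in the certifier's own basis (clause: per orbit of
the cube `K+1`, the certifier's vectors are transversal, class II, conjugate-symmetric, real-orthonormal,
`odim O` in number). Mathlib + the two files named; no new definitions.
-/

noncomputable section

open scoped BigOperators ComplexConjugate InnerProductSpace Matrix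
open Finset Matrix

namespace Summit.NavierStokesRegularity.FluidComputer.AbcClassII

open Literature.Analysis.FunctionSpaces Literature.Analysis.FunctionSpaces.Torus
open Literature.Analysis.FunctionSpaces.EuclideanSpace
open Literature.Analysis.FluidPDE Literature.Analysis.FluidPDE.SteadyLattice

/-! ## Part A2′/A3. Open bracket and rung R-α in arbitrary orbit bases (instab4 g7) -/

section BasesOpen

variable (e : ∀ O : Orbit, OrthonormalBasis (Fin (odim O)) ℝ (realSpace O.1))
variable (bf : Idx → Fam)
variable (hbf : ∀ i : Idx, bf i = extend i.1.1 ((e i.1 i.2 : realSpace i.1.1) : EuclideanSpace ℂ (↥i.1.1 × Fin 3)))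
variable (am : Idx → Idx → ℝ)
variable (ham : ∀ i j : Idx, am i j =
  (∑ k ∈ i.1.1, (inner ℂ (bf i k) (Torus.lerayCoeff k (crossForm 1 1 1 (bf j) k)) : ℂ)).re)

include hbf ham

/-- **THE OPEN BRACKET FROM THE CERTIFICATE'S THREE NUMBERS, IN ARBITRARY ORTHONORMAL ORBIT BASES.**
Hypotheses VERBATIM those of `isLinNSEigenvalue_of_certificate_of_bases` ((T1) head determinant signs,
(T2) shell numbers in the Schur form `Λ − √2 − C A⁻¹ B`, (T3) tail constants, all about
`[(x + |O|²/R)δ − am]` for the first-order matrix `am` of the basis families of `e`); conclusion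
`∃ λ ∈ (x₁, x₂)` OPEN, `Torus.IsLinNSEigenvalue (1/(2πR)) (Torus.abcFlow 1 1 1) (2πλ)`. -/
theorem isLinNSEigenvalue_Ioo_of_certificate_of_bases {R : ℝ} (hR : 1 ≤ R) (K : ℕ) {x₁ x₂ : ℝ}
    (hlt : x₁ < x₂) (μ₁ μ₂ : ℝ) (hμ₁ : 0 < μ₁) (hμ₂ : 0 < μ₂)
    (hq₁ : μ₁ ≤ x₁ + ((K : ℝ) + 2) ^ 2 / R - Real.sqrt 2) (hq₂ : μ₂ ≤ x₂ + ((K : ℝ) + 2) ^ 2 / R - Real.sqrt 2)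
    (hdet : (Matrix.of fun a b : ↥(cubeIdx K) =>
        (if (a : Idx) = b then x₁ + onormSq (b : Idx).1 / R else 0) - am a b).det *
      (Matrix.of fun a b : ↥(cubeIdx K) =>
        (if (a : Idx) = b then x₂ + onormSq (b : Idx).1 / R else 0) - am a b).det < 0)
    (hX₁ : ∀ w : ↥(cubeIdx (K + 1) \ cubeIdx K) → ℝ, μ₁ * (w ⬝ᵥ w) ≤
      ∑ a : ↥(cubeIdx (K + 1) \ cubeIdx K), (x₁ + onormSq (a : Idx).1 / R) * w a ^ 2 - Real.sqrt 2 * (w ⬝ᵥ w) -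
        w ⬝ᵥ (((Matrix.of fun (a : ↥(cubeIdx (K + 1) \ cubeIdx K)) (b : ↥(cubeIdx K)) =>
            (if (a : Idx) = b then x₁ + onormSq (b : Idx).1 / R else 0) - am a b) *
          (Matrix.of fun a b : ↥(cubeIdx K) =>
            (if (a : Idx) = b then x₁ + onormSq (b : Idx).1 / R else 0) - am a b)⁻¹ *
          (Matrix.of fun (a : ↥(cubeIdx K)) (b : ↥(cubeIdx (K + 1) \ cubeIdx K)) =>
            (if (a : Idx) = b then x₁ + onormSq (b : Idx).1 / R else 0) - am a b)) *ᵥ w))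
    (hX₂ : ∀ w : ↥(cubeIdx (K + 1) \ cubeIdx K) → ℝ, μ₂ * (w ⬝ᵥ w) ≤
      ∑ a : ↥(cubeIdx (K + 1) \ cubeIdx K), (x₂ + onormSq (a : Idx).1 / R) * w a ^ 2 - Real.sqrt 2 * (w ⬝ᵥ w) -
        w ⬝ᵥ (((Matrix.of fun (a : ↥(cubeIdx (K + 1) \ cubeIdx K)) (b : ↥(cubeIdx K)) =>
            (if (a : Idx) = b then x₂ + onormSq (b : Idx).1 / R else 0) - am a b) *
          (Matrix.of fun a b : ↥(cubeIdx K) =>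
            (if (a : Idx) = b then x₂ + onormSq (b : Idx).1 / R else 0) - am a b)⁻¹ *
          (Matrix.of fun (a : ↥(cubeIdx K)) (b : ↥(cubeIdx (K + 1) \ cubeIdx K)) =>
            (if (a : Idx) = b then x₂ + onormSq (b : Idx).1 / R else 0) - am a b)) *ᵥ w)) :
    ∃ lam ∈ Set.Ioo x₁ x₂,
      Torus.IsLinNSEigenvalue (1 / (2 * Real.pi * R)) (Torus.abcFlow 1 1 1) ((2 * Real.pi * lam : ℝ) : ℂ) :=
  AbcClassIIOpenBracket.isLinNSEigenvalue_Ioo_of_certificate hR K hlt μ₁ μ₂ hμ₁ hμ₂ hq₁ hq₂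
    (head_sign_transfer e bf hbf am ham R K x₁ x₂ hdet)
    (shell_form_transfer e bf hbf am ham R K x₁ μ₁ hX₁)
    (shell_form_transfer e bf hbf am ham R K x₂ μ₂ hX₂)

/-- **Rung R-α from the certificate's three numbers, in arbitrary orthonormal orbit bases**
(CONDITIONAL on the named fact `Torus.fps2006_nonlinear_instability_of_eigenvalue`,
Friedlander–Pavlović–Shvydkoy 2006 Thm 2.2): under the hypotheses of
`isLinNSEigenvalue_Ioo_of_certificate_of_bases` and `0 ≤ x₁`, the forced ABC flow (`A = B = C = 1`,
viscosity `1/(2πR)` on the unit torus, force `4π²ν·U`) is a Lyapunov-unstable steady state of the TRUE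
forced Navier–Stokes dynamics — an INSTABILITY statement; not blow-up, not Clay (A)/(C)/(D). -/
theorem isLyapunovUnstable_of_certificate_of_bases
    (hFPS : Torus.fps2006_nonlinear_instability_of_eigenvalue)
    {R : ℝ} (hR : 1 ≤ R) (K : ℕ) {x₁ x₂ : ℝ} (hx₁ : 0 ≤ x₁) (hlt : x₁ < x₂)
    (μ₁ μ₂ : ℝ) (hμ₁ : 0 < μ₁) (hμ₂ : 0 < μ₂)
    (hq₁ : μ₁ ≤ x₁ + ((K : ℝ) + 2) ^ 2 / R - Real.sqrt 2) (hq₂ : μ₂ ≤ x₂ + ((K : ℝ) + 2) ^ 2 / R - Real.sqrt 2)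
    (hdet : (Matrix.of fun a b : ↥(cubeIdx K) =>
        (if (a : Idx) = b then x₁ + onormSq (b : Idx).1 / R else 0) - am a b).det *
      (Matrix.of fun a b : ↥(cubeIdx K) =>
        (if (a : Idx) = b then x₂ + onormSq (b : Idx).1 / R else 0) - am a b).det < 0)
    (hX₁ : ∀ w : ↥(cubeIdx (K + 1) \ cubeIdx K) → ℝ, μ₁ * (w ⬝ᵥ w) ≤
      ∑ a : ↥(cubeIdx (K + 1) \ cubeIdx K), (x₁ + onormSq (a : Idx).1 / R) * w a ^ 2 - Real.sqrt 2 * (w ⬝ᵥ w) -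
        w ⬝ᵥ (((Matrix.of fun (a : ↥(cubeIdx (K + 1) \ cubeIdx K)) (b : ↥(cubeIdx K)) =>
            (if (a : Idx) = b then x₁ + onormSq (b : Idx).1 / R else 0) - am a b) *
          (Matrix.of fun a b : ↥(cubeIdx K) =>
            (if (a : Idx) = b then x₁ + onormSq (b : Idx).1 / R else 0) - am a b)⁻¹ *
          (Matrix.of fun (a : ↥(cubeIdx K)) (b : ↥(cubeIdx (K + 1) \ cubeIdx K)) =>
            (if (a : Idx) = b then x₁ + onormSq (b : Idx).1 / R else 0) - am a b)) *ᵥ w))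
    (hX₂ : ∀ w : ↥(cubeIdx (K + 1) \ cubeIdx K) → ℝ, μ₂ * (w ⬝ᵥ w) ≤
      ∑ a : ↥(cubeIdx (K + 1) \ cubeIdx K), (x₂ + onormSq (a : Idx).1 / R) * w a ^ 2 - Real.sqrt 2 * (w ⬝ᵥ w) -
        w ⬝ᵥ (((Matrix.of fun (a : ↥(cubeIdx (K + 1) \ cubeIdx K)) (b : ↥(cubeIdx K)) =>
            (if (a : Idx) = b then x₂ + onormSq (b : Idx).1 / R else 0) - am a b) *
          (Matrix.of fun a b : ↥(cubeIdx K) =>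
            (if (a : Idx) = b then x₂ + onormSq (b : Idx).1 / R else 0) - am a b)⁻¹ *
          (Matrix.of fun (a : ↥(cubeIdx K)) (b : ↥(cubeIdx (K + 1) \ cubeIdx K)) =>
            (if (a : Idx) = b then x₂ + onormSq (b : Idx).1 / R else 0) - am a b)) *ᵥ w)) :
    Torus.IsLyapunovUnstableSteadyState (1 / (2 * Real.pi * R))
      (fun x => (4 * Real.pi ^ 2 * (1 / (2 * Real.pi * R))) • Torus.abcFlow 1 1 1 x) (Torus.abcFlow 1 1 1) :=
  AbcClassIIOpenBracket.isLyapunovUnstable_of_certificate hFPS hR K hx₁ hlt μ₁ μ₂ hμ₁ hμ₂ hq₁ hq₂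
    (head_sign_transfer e bf hbf am ham R K x₁ x₂ hdet)
    (shell_form_transfer e bf hbf am ham R K x₁ μ₁ hX₁)
    (shell_form_transfer e bf hbf am ham R K x₂ μ₂ hX₂)

end BasesOpen

end Summit.NavierStokesRegularity.FluidComputer.AbcClassII

end
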